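import Literature.NumberTheory.GaloisRepresentations.CoinducedKummerSequencePiecesPositiveDegree
import Literature.RepresentationTheory.FiniteGroups.StableLatticeReductionFiniteTorsionAgnostic
import HarnessLib

/-!
# The three Kummer pieces summed: `[𝓗⁰(B[p])] + [𝓗²(B[p])] + [B^W/p] = [𝓗¹(B[p])] + [B^W[p]] + [𝓗²(B)[p]]`

Topic `NumberTheory/GaloisRepresentations` (continuous cochain cohomology); namespace
`Literature.NumberTheory.GaloisRepresentations`.  THEOREMS ONLY (no definition, no named fact, no `sorry`,
no instance).  Sequel of `CoinducedKummerSequencePieces` / `…PositiveDegree` (the `Δ`-equivariant Kummer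
pieces of a `p`-divisible discrete `G`-module `B` in the right-action model `𝓗ⁿ(–) = Hⁿ(G, Maps(G ⧸ W, –))`)
and of `StableLatticeReductionFiniteTorsionAgnostic` (`[X/pX] = [X[p]]` for finite `X`, instance-polymorphic).

* `moduleFinite_coindOpen_invariants`, `finite_torsionBy_coindOpen_invariants` — `Maps(Δ, B)^G ≅ B^W`
  (`coindOpenInvariantsEquiv`) inherits finite generation / finite `p`-torsion;
* **`additive_coindOpen_torsionBy_euler`** — for every additive invariant `ψ` of finite `p`-torsion
  `ℤ[Δ]`-modules (B3a-β binder pair; strict-implicit instance binders, cf. `AdditiveInvariantExactPieces`):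
  if `𝓗¹(B)` is finite, the `p`-torsion of `𝓗²(B)` is finite and `B^W` is finitely generated with finite
  `p`-torsion and finite reduction, then for any `Δ`-stable `N₂ ⊆ 𝓗²(B)` cut out by `(p : ℤ) • t = 0`,
  `ψ(𝓗⁰(B[p])) + ψ(𝓗²(B[p])) + ψ(B^W/p) = ψ(𝓗¹(B[p])) + ψ(B^W[p]) + ψ(N₂)`;
* `quotient_comp_eq`, `subrepresentation_comp_eq` — pull-back along `φ : Δ′ →* G′` commutes with
  quotients / subrepresentations (definitional; used to move between `(τ ∘ φ)/N` and `(τ/N) ∘ φ`).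

Lane «TATE-EPC-TC» of cell `bsd-eis` (crux `GoodLatticeBDPValue`, stmt-BirchSwinnertonDyer-19032), brick
B8-arith ≡ B6b: with `B = E_S` this is `[𝓗⁰(μ_p)] − [𝓗¹(μ_p)] + [𝓗²(μ_p)] = [E_S^W[p]] − [E_S^W/p] + [𝓗²(E_S)[p]]`
(Milne *ADT* I §5).  HONEST FRAMING: homological algebra only; no arithmetic statement is proved here.

## References
* J. S. Milne, *Arithmetic Duality Theorems*, 2nd ed. (2006), I §5 (proof of Thm. 5.1). [MilneADT2006]
* J. Neukirch, A. Schmidt, K. Wingberg, *Cohomology of Number Fields*, 2nd ed. (2008), (1.3.2)–(1.3.3), I §6.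
  [NeukirchSchmidtWingberg2008]
* J.-P. Serre, *Représentations linéaires des groupes finis* (1977), §15.2. [SerreLinearRepresentations1977]
-/

noncomputable section

open CategoryTheory Function Submodule
open scoped Pointwise

namespace Literature.NumberTheory.GaloisRepresentations

open _root_.TopRep _root_.ContRepresentation _root_.ContinuousCohomology
open Literature.RepresentationTheory.FiniteGroups.StableLatticeReduction (smul_top_le_comap torsionBy_le_comap
  Int.finite_quotient_smul_top Int.additive_quotient_eq_subrepresentation_of_finite)

section Generic

universe u

variable {G : Type u} [Group G] [TopologicalSpace G] [IsTopologicalGroup G] [CompactSpace G]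
variable {B : Type u} [AddCommGroup B] [TopologicalSpace B] [DiscreteTopology B]
variable (ρ : ContinuousRep G ℤ B) (W : Subgroup G) [W.Normal] (hW : IsOpen (W : Set G))

/-- `Maps(G ⧸ W, B)^G ≅ B^W` (`coindOpenInvariantsEquiv`) is finitely generated when `B^W` is.
[cite: NeukirchSchmidtWingberg2008, I §6 (induced modules)] -/
theorem moduleFinite_coindOpen_invariants [Module.Finite ℤ (ρ.invariantsOf W)] :
    Module.Finite ℤ (ρ.coindOpen W hW).toTopRep.ρ.invariants :=
  Module.Finite.equiv (ρ.coindOpenInvariantsEquiv W hW).symm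

/-- The `p`-torsion of `Maps(G ⧸ W, B)^G ≅ B^W` is finite when that of `B^W` is.
[cite: NeukirchSchmidtWingberg2008, I §6 (induced modules)] -/
theorem finite_torsionBy_coindOpen_invariants (p : ℕ) [Finite (torsionBy ℤ (ρ.invariantsOf W) (p : ℤ))] :
    Finite (torsionBy ℤ (ρ.coindOpen W hW).toTopRep.ρ.invariants (p : ℤ)) := by
  have hmem : ∀ x : torsionBy ℤ (ρ.coindOpen W hW).toTopRep.ρ.invariants (p : ℤ),
      ρ.coindOpenInvariantsEquiv W hW x ∈ torsionBy ℤ (ρ.invariantsOf W) (p : ℤ) := fun x => by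
    rw [mem_torsionBy_iff, ← map_smul, (mem_torsionBy_iff _ _).1 x.2, map_zero]
  refine Finite.of_injective (fun x => (⟨_, hmem x⟩ : torsionBy ℤ (ρ.invariantsOf W) (p : ℤ)))
    fun x y hxy => Subtype.ext ((ρ.coindOpenInvariantsEquiv W hW).injective (congrArg Subtype.val hxy))

variable {A : Type*} [AddCommGroup A] (p : ℕ)
variable (ψ : ∀ ⦃X : Type u⦄ ⦃_ : AddCommGroup X⦄ ⦃_ : Module ℤ X⦄, Representation ℤ (G ⧸ W) X → A)
  (hψ : ∀ ⦃X Y Z : Type u⦄ [AddCommGroup X] [Module ℤ X] [AddCommGroup Y] [Module ℤ Y]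
    [AddCommGroup Z] [Module ℤ Z] (ρX : Representation ℤ (G ⧸ W) X) (ρY : Representation ℤ (G ⧸ W) Y)
    (ρZ : Representation ℤ (G ⧸ W) Z) (f : X →ₗ[ℤ] Y) (g : Y →ₗ[ℤ] Z),
    (∀ s x, f (ρX s x) = ρY s (f x)) → (∀ s y, g (ρY s y) = ρZ s (g y)) →
    Injective f → Surjective g → LinearMap.range f = LinearMap.ker g → Finite Y →
    (∀ y : Y, (p : ℤ) • y = 0) → ψ ρY = ψ ρX + ψ ρZ)

include hψ in
/-- **The three Kummer pieces summed** (generic): for a `p`-divisible discrete `G`-module `B` with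
`𝓗¹(B)` finite, the `p`-torsion of `𝓗²(B)` finite and `B^W` with finite `p`-torsion and finite reduction
mod `p`, and any `Δ`-stable `N₂ ⊆ 𝓗²(B)` cut out by `(p : ℤ) • t = 0`,
`ψ(𝓗⁰(B[p])) + ψ(𝓗²(B[p])) + ψ(B^W/p) = ψ(𝓗¹(B[p])) + ψ(B^W[p]) + ψ(N₂)`
(`[𝓗⁰(B[p])] = [B^W[p]]`, `[𝓗¹(B[p])] = [B^W/p] + [𝓗¹(B)[p]]`, `[𝓗²(B[p])] = [𝓗¹(B)/p] + [𝓗²(B)[p]]` and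
`[𝓗¹(B)/p] = [𝓗¹(B)[p]]` for the finite `𝓗¹(B)`). [cite: MilneADT2006, I §5 (proof of Thm. 5.1)]
[cite: NeukirchSchmidtWingberg2008, (1.3.2)–(1.3.3)] -/
theorem additive_coindOpen_torsionBy_euler [LocallyCompactSpace G] [T2Space G] [Fact p.Prime]
    (hdiv : Surjective fun b : B => (p : ℤ) • b)
    [Finite (continuousCohomology 1 (ρ.coindOpen W hW).toTopRep)]
    (hTor2 : {y : continuousCohomology 2 (ρ.coindOpen W hW).toTopRep | p • y = 0}.Finite)
    [Finite ((ρ.invariantsOf W) ⧸ ((p : ℤ) • ⊤ : Submodule ℤ (ρ.invariantsOf W)))]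
    [Finite (torsionBy ℤ (ρ.invariantsOf W) (p : ℤ))] [Module.Finite ℤ (ρ.invariantsOf W)]
    (N₂ : Submodule ℤ (continuousCohomology 2 (ρ.coindOpen W hW).toTopRep))
    (hN₂ : ∀ t, t ∈ N₂ ↔ (p : ℤ) • t = 0) (hN₂st : ∀ c, N₂ ≤ N₂.comap (ρ.coindOpenHRep W hW 2 c)) :
    ψ ((ρ.subrepresentation (torsionBy ℤ B (p : ℤ)) (torsionBy_le_comap ρ.toRepresentation (p : ℤ))).coindOpenInvariantsRep
        W hW) +
      ψ ((ρ.subrepresentation (torsionBy ℤ B (p : ℤ)) (torsionBy_le_comap ρ.toRepresentation (p : ℤ))).coindOpenHRep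
        W hW 2) +
      ψ ((ρ.quotientInvariants W).toRepresentation.quotient ((p : ℤ) • ⊤) (smul_top_le_comap _ (p : ℤ))) =
    ψ ((ρ.subrepresentation (torsionBy ℤ B (p : ℤ)) (torsionBy_le_comap ρ.toRepresentation (p : ℤ))).coindOpenHRep
        W hW 1) +
      ψ ((ρ.quotientInvariants W).toRepresentation.subrepresentation (torsionBy ℤ (ρ.invariantsOf W) (p : ℤ))
        (torsionBy_le_comap _ (p : ℤ))) +
      ψ ((ρ.coindOpenHRep W hW 2).subrepresentation N₂ hN₂st) := by
  haveI : DiscreteTopology (G ⧸ W → B) := ContinuousRep.discreteTopology_coindOpen W hW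
  haveI : DiscreteTopology (G ⧸ W → torsionBy ℤ B (p : ℤ)) := ContinuousRep.discreteTopology_coindOpen W hW
  -- `𝓗⁰(B) ≅ B^W`: finiteness of its reduction mod `p` and of its `p`-torsion
  haveI := moduleFinite_coindOpen_invariants ρ W hW
  haveI : Finite ((ρ.coindOpen W hW).toTopRep.ρ.invariants ⧸
      ((p : ℤ) • ⊤ : Submodule ℤ (ρ.coindOpen W hW).toTopRep.ρ.invariants)) :=
    Int.finite_quotient_smul_top (by exact_mod_cast (Fact.out : p.Prime).ne_zero)
  haveI := finite_torsionBy_coindOpen_invariants ρ W hW p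
  -- the `p`-multiples / `p`-torsion of `𝓗¹(B)`: image / kernel of `𝓗¹(p•)`
  obtain ⟨ι, μ, -, hμ, -⟩ := ρ.exists_kummer_isSES p hdiv
  have hπ : ∀ x, (cohomologyMap (ρ.coindOpenMap ρ W hW μ) 1).hom.toLinearMap x = (p : ℤ) • x := fun x =>
    ρ.cohomologyMap_coindOpenMap_smul_apply W hW p μ hμ 1 x
  have hcomm : ∀ c x, (cohomologyMap (ρ.coindOpenMap ρ W hW μ) 1).hom.toLinearMap (ρ.coindOpenHRep W hW 1 c x) =
      ρ.coindOpenHRep W hW 1 c ((cohomologyMap (ρ.coindOpenMap ρ W hW μ) 1).hom.toLinearMap x) := fun c x =>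
    (ρ.coindOpenHRep_cohomologyMap ρ W hW μ 1 c x).symm
  have hN₁ : ∀ t, t ∈ LinearMap.ker (cohomologyMap (ρ.coindOpenMap ρ W hW μ) 1).hom.toLinearMap ↔
      (p : ℤ) • t = 0 := fun t => by rw [LinearMap.mem_ker, hπ]
  have hN₁' : ∀ x, x ∈ LinearMap.range (cohomologyMap (ρ.coindOpenMap ρ W hW μ) 1).hom.toLinearMap ↔
      ∃ y : continuousCohomology 1 (ρ.coindOpen W hW).toTopRep, (p : ℤ) • y = x := fun x => by
    simp only [LinearMap.mem_range, hπ]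
  have hN₁st := Literature.RepresentationTheory.FiniteGroups.StableLatticeReduction.ker_le_comap_of_comm _ _ _ hcomm
  have hN₁'st := Literature.RepresentationTheory.FiniteGroups.StableLatticeReduction.range_le_comap_of_comm _ _ _ hcomm
  have hN₀ : ∀ v : (ρ.coindOpen W hW).toTopRep.ρ.invariants,
      v ∈ ((p : ℤ) • ⊤ : Submodule ℤ (ρ.coindOpen W hW).toTopRep.ρ.invariants) ↔
        ∃ w : (ρ.coindOpen W hW).toTopRep.ρ.invariants, (p : ℤ) • w = v := fun v => by
    rw [mem_smul_pointwise_iff_exists]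
    exact ⟨fun ⟨w, _, h⟩ => ⟨w, h⟩, fun ⟨w, h⟩ => ⟨w, mem_top, h⟩⟩
  haveI : Finite (LinearMap.ker (cohomologyMap (ρ.coindOpenMap ρ W hW μ) 1).hom.toLinearMap) :=
    Finite.of_injective _ Subtype.val_injective
  haveI : Finite (continuousCohomology 1 (ρ.coindOpen W hW).toTopRep ⧸
      LinearMap.range (cohomologyMap (ρ.coindOpenMap ρ W hW μ) 1).hom.toLinearMap) :=
    Finite.of_surjective _ (Submodule.mkQ_surjective _)
  haveI : Finite N₂ := by
    have hset : (SetLike.coe N₂) = {y : continuousCohomology 2 (ρ.coindOpen W hW).toTopRep | p • y = 0} := by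
      ext t
      rw [SetLike.mem_coe, hN₂, Set.mem_setOf_eq, natCast_zsmul]
    exact (Set.finite_coe_iff.2 (hset ▸ hTor2) :)
  haveI := ρ.finite_continuousCohomology_one_coindOpen_torsionBy W hW p hdiv _ hN₀ _ hN₁
  haveI := ρ.finite_continuousCohomology_two_coindOpen_torsionBy W hW p hdiv _ hN₁' N₂ hN₂
  -- the pieces
  have e1 := ρ.additive_coindOpenHRep_one_torsionBy W hW p ψ hψ hdiv _ hN₀ (smul_top_le_comap _ (p : ℤ)) _ hN₁ hN₁st
  have e2 := ρ.additive_coindOpenHRep_two_torsionBy W hW p ψ hψ hdiv _ hN₁' hN₁'st N₂ hN₂ hN₂st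
  have e3 := Int.additive_quotient_eq_subrepresentation_of_finite ψ hψ (ρ.coindOpenHRep W hW 1) _ _ hN₁' hN₁
    hN₁'st hN₁st
  have e0 := (ρ.additive_coindOpenInvariantsRep_torsionBy W hW p ψ hψ).trans
    (ρ.additive_coindOpenInvariantsRep_torsionBy_eq_invariantsOf W hW p ψ hψ)
  have q0 := ρ.additive_coindOpenInvariantsRep_quotient W hW p ψ hψ
  -- first-order assembly
  have key : ∀ (H0 H1 H2 P0 Q0 Q0' N1 M1 N2 : A), H0 = P0 → Q0' = Q0 → H1 = Q0' + N1 → H2 = M1 + N2 →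
      M1 = N1 → H0 + H2 + Q0 = H1 + P0 + N2 := by
    intro H0 H1 H2 P0 Q0 Q0' N1 M1 N2 h0 hq h1 h2 h3
    subst h0 hq h1 h2 h3
    abel
  exact key _ _ _ _ _ _ _ _ _ e0 q0 e1 e2 e3

/-- **Quotient and pull-back commute**: for `φ : Δ →* G`, the pull-back of the quotient representation
`V/N` is the quotient of the pull-back (definitional; stated with both stability proofs arbitrary so that it
rewrites in either direction). [cite: SerreLinearRepresentations1977, §15.2] -/
theorem quotient_comp_eq {k : Type*} [CommRing k] {G' Δ' : Type*} [Monoid G'] [Monoid Δ'] {V : Type*}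
    [AddCommGroup V] [Module k V] (τ : Representation k G' V) (φ : Δ' →* G') (N : Submodule k V)
    (h : ∀ g, N ≤ N.comap (τ g)) (h' : ∀ d, N ≤ N.comap ((τ.comp φ) d)) :
    (τ.quotient N h).comp φ = Representation.quotient (τ.comp φ) N h' := rfl

/-- **Subrepresentation and pull-back commute** (definitional, both stability proofs arbitrary).
[cite: SerreLinearRepresentations1977, §15.2] -/
theorem subrepresentation_comp_eq {k : Type*} [CommRing k] {G' Δ' : Type*} [Monoid G'] [Monoid Δ']
    {V : Type*} [AddCommGroup V] [Module k V] (τ : Representation k G' V) (φ : Δ' →* G') (N : Submodule k V)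
    (h : ∀ g, N ≤ N.comap (τ g)) (h' : ∀ d, N ≤ N.comap ((τ.comp φ) d)) :
    (τ.subrepresentation N h).comp φ = Representation.subrepresentation (τ.comp φ) N h' := rfl

end Generic


end Literature.NumberTheory.GaloisRepresentations

end
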